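import Summits.CriticalPhenomena.PercolationContinuityZ3.Theorems.PercNearOneGluingNoHeavyQuantGluedDomination
import Summits.CriticalPhenomena.PercolationContinuityZ3.Theorems.PercNearOneGluingNoHeavyQuantPiecewiseSibling
import HarnessLib

/-!
# QUANT lane R8, T-DEC: the GLUED-PIECE SLICE in EVERY regime from `LawDec.GluedDominated` — the low piece (two heavy blobs) and the light piece
# (COMP-SLICE) are theorems, the margin is arm-1 g57's `sdec_gluedPiece_of_margin`, the band is `sdec_gluedPiece_band_of_dominated`; hence
# `GluedDominated ⟹` hypothesis `hGPS` of `sdec_cons_of_okPieces` verbatim (arm-1 gen 58, architect)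

builds on p205010 (kernel theorem, internal audit signed; external expert review pending)

Support file (`--supports stmt-CriticalPhenomena-4575`), QUANT lane seat prim-quant-arm-1 (gen 58, architect); memo
`run/shared/lean/prim/quant/prim-quant-arm-1-g58/ARCH-G58.md` §0, §3.  Theorems only; standard axioms, no sorries.

The glued piece `t = gate {r, r+k; g} q = {0: 1−q, r: q(1−g), r+k: qg}` has mean `m = q(r+kg)`; for an affordable (`x(r+k) ≤ m`) on-floor (`x ≤ qg`)
piece adjoined to an SDEC affordable law `β` on `{0..B}`:
* `m ≤ r` (LOW piece): `t = w·Bl(r, m/r) + (1−w)·Bl(r+k, m/(r+k))`, `w = q(1−g)r/m` (`gluedPiece_split_low`), two HEAVY blobs of the common mean `m`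
  (`m/(r+k) ≥ x` is affordability) ⟹ two heavy blob slices (`sdec_slice'`) and `sdec_of_mixture`: **`sdec_gluedPiece_of_low`**.
* `r ≤ m ≤ 2r` (LIGHT piece): in arm-1 g57's `gluedPiece_split` the piece `{r, r+k; θ₃}`, `θ₃ = (m−r)/k`, is LIGHT (`kθ₃ ≤ r`) and affordable, so
  COMP-SLICE `sdec_lightPiece` (arm-1 g57) + the blob slice + `sdec_of_mixture`: **`sdec_gluedPiece_of_light`**.
* `2r < m`, `kx ≤ m − r` (MARGIN): `sdec_gluedPiece_of_margin` (arm-1 g57).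
* `2r < m`, `m − r < kx` (BAND): `sdec_gluedPiece_band_of_dominated` from the `@[conjecture]` `GluedDominated` (`…QuantGluedDomination`).
* **`gluedPieceSlice_of_band`**: the glued-piece slice for EVERY affordable on-floor piece — the hypothesis `hGPS` of `sdec_cons_of_okPieces`
  (`…QuantPiecewiseSibling`) verbatim — follows from its BAND alone (spelled out as the hypothesis `hBand`); `sdec_cons_of_okPieces_of_band`.
  So the law-level R8 node owes EXACTLY the band.
* **`gluedPieceSlice_of_dominated : GluedDominated →`** `hGPS`; **`sdec_cons_of_okPieces_of_dominated`**: given `GluedDominated`, a law-OK affordable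
  sibling whose sub-forest law splits into light / blob / floored / on-floor-glued pieces is adjoinable to ANY SDEC forest (by arm-1 g57's census, every
  sampled tree-OK sibling — ARCH-G57 §7).

HONEST STATUS.  `GluedDominated` OPEN (numerical evidence in `…QuantGluedDomination`); `SiblingStep` / `GateStepN` / `LightResidDECOracle` / `FarTreeRow`
OPEN; RATE class (log\*) / honest sentence of `run/shared/lean/prim/quant/README.md` unchanged.  [this work].  Nothing here is cited as a published
result.  The gluing rows served [cite: KozmaNitzan2024, Conjecture 3 (p. 15)]; product measure [cite: Grimmett1999, §1.3 p. 10].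
-/

noncomputable section

open scoped BigOperators

namespace Summit.CriticalPhenomena.PercolationContinuityZ3.Theorems
namespace Quant

open Finset

namespace LawDec

/-- the point mass `δ_K` -/
local notation3 "δ[" K "]" => (fun k : ℕ => if k = (K : ℕ) then (1 : ℝ) else 0)

/-- the two-point law `{lo, lo+K; g}` = `lo` sure relays and a blob of size `K` at gate `g` -/
local notation3 "TPL[" lo ", " K ", " g "]" => lconv lo K δ[lo] (gate δ[K] g)

/-! ### The low piece and the light piece -/

/-- **the split of a LOW glued piece** (`0 < m = q(r+kg) ≤ r`): `gate {r,r+k;g} q = w·gate δ_r (m/r) + (1−w)·gate δ_{r+k} (m/(r+k))`,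
`w = q(1−g)r/m`, `1 − w = qg(r+k)/m` — two heavy blobs of the common mean `m`. [this work] -/
theorem gluedPiece_split_low (q g : ℝ) (r k : ℕ) (hq0 : 0 < q) (hg0 : 0 ≤ g) (hg1 : g ≤ 1) (hr : 1 ≤ r) (hk : 1 ≤ k) :
    let m : ℝ := q * ((r : ℝ) + k * g)
    let w : ℝ := q * (1 - g) * r / m
    0 < m ∧ 0 ≤ w ∧ w ≤ 1 ∧ 1 - w = q * g * ((r : ℝ) + k) / m ∧
      ∀ h : ℕ, gate (TPL[r, k, g]) q h = w * gate δ[r] (m / r) h + (1 - w) * gate δ[r + k] (m / ((r : ℝ) + k)) h := by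
  intro m w
  have hr1 : (1 : ℝ) ≤ r := by exact_mod_cast hr
  have hk0 : (0 : ℝ) ≤ k := Nat.cast_nonneg k
  have hm0 : 0 < m := by
    show 0 < q * ((r : ℝ) + k * g)
    have : 0 < (r : ℝ) + k * g := by nlinarith
    positivity
  have hw0 : 0 ≤ w := div_nonneg (mul_nonneg (mul_nonneg hq0.le (by linarith)) (by linarith)) hm0.le
  have h1w : 1 - w = q * g * ((r : ℝ) + k) / m := by
    show 1 - q * (1 - g) * r / m = q * g * ((r : ℝ) + k) / m
    rw [eq_div_iff hm0.ne', sub_mul, div_mul_cancel₀ _ hm0.ne', one_mul]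
    show q * ((r : ℝ) + k * g) - q * (1 - g) * r = q * g * ((r : ℝ) + k)
    ring
  have hw1 : w ≤ 1 := by
    have : 0 ≤ q * g * ((r : ℝ) + k) / m := div_nonneg (by positivity) hm0.le
    linarith
  refine ⟨hm0, hw0, hw1, h1w, fun h => ?_⟩
  have hr0 : (r : ℝ) ≠ 0 := by positivity
  have hrk0 : ((r : ℝ) + k) ≠ 0 := by positivity
  have cr : w * (m / r) = q * (1 - g) := by
    show q * (1 - g) * r / m * (m / r) = q * (1 - g)
    field_simp
  have crk : (1 - w) * (m / ((r : ℝ) + k)) = q * g := by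
    rw [h1w]; field_simp
  have c0 : w * (1 - m / r) + (1 - w) * (1 - m / ((r : ℝ) + k)) = 1 - q := by
    have : w * (1 - m / r) + (1 - w) * (1 - m / ((r : ℝ) + k)) = 1 - (w * (m / r)) - ((1 - w) * (m / ((r : ℝ) + k))) := by ring
    rw [this, cr, crk]; ring
  have hr0' : r ≠ 0 := by omega
  have hk0' : k ≠ 0 := by omega
  simp only [gate_apply, tpLaw_apply]
  split_ifs <;> first
    | (exfalso; omega)
    | linear_combination c0
    | linear_combination (-1 : ℝ) * c0
    | linear_combination cr
    | linear_combination (-1 : ℝ) * cr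
    | linear_combination crk
    | linear_combination (-1 : ℝ) * crk
    | ring

/-- **THE GLUED-PIECE SLICE FOR A LOW PIECE** (`q(r+kg) ≤ r`): both blobs of `gluedPiece_split_low` are heavy (`m/(r+k) ≥ x` is affordability,
`m/r ≥ m/(r+k)`), so `β ∗ t` is a same-mean mixture of two heavy blob slices (`sdec_slice'`, `sdec_of_mixture`). [this work] -/
theorem sdec_gluedPiece_of_low {x : ℝ} (hx0 : 0 < x) (hx1 : x < 1) {B : ℕ} {β : ℕ → ℝ} (β0 : ∀ h, 0 ≤ β h)
    (βM : ∀ h, B < h → β h = 0) (β1 : ∑ h ∈ Finset.range (B + 1), β h = 1)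
    (hta : x * (B : ℝ) ≤ ∑ h ∈ Finset.range (B + 1), (h : ℝ) * β h) (hS : SDEC x B β)
    (q g : ℝ) (r k : ℕ) (hq0 : 0 < q) (hq1 : q < 1) (hg0 : 0 ≤ g) (hg1 : g ≤ 1) (hr : 1 ≤ r) (hk : 1 ≤ k)
    (haff : x * ((r : ℝ) + k) ≤ q * ((r : ℝ) + k * g)) (hmr : q * ((r : ℝ) + k * g) ≤ r) :
    SDEC x (B + (r + k)) (lconv B (r + k) β (gate (TPL[r, k, g]) q)) := by
  obtain ⟨hm0, hw0, hw1, h1w, hsplit⟩ := gluedPiece_split_low q g r k hq0 hg0 hg1 hr hk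
  set m : ℝ := q * ((r : ℝ) + k * g) with hm
  set w : ℝ := q * (1 - g) * r / m with hw
  set S : ℝ := ∑ h ∈ Finset.range (B + 1), (h : ℝ) * β h with hSdef
  have hr1 : (1 : ℝ) ≤ r := by exact_mod_cast hr
  have hk0 : (0 : ℝ) ≤ k := Nat.cast_nonneg k
  have hr0 : (0 : ℝ) < r := by linarith
  have hrk0 : (0 : ℝ) < (r : ℝ) + k := by linarith
  have hv : x ≤ m / ((r : ℝ) + k) := by rw [le_div_iff₀ hrk0]; exact haff
  have hv1 : m / ((r : ℝ) + k) ≤ 1 := by rw [div_le_one hrk0]; linarith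
  have hu : x ≤ m / r := le_trans hv (by rw [hm]; exact div_le_div_of_nonneg_left hm0.le hr0 (by linarith))
  have hu1 : m / r ≤ 1 := by rw [div_le_one hr0]; exact hmr
  set μ₁ : ℕ → ℝ := lconv B (r + k) β (gate δ[r] (m / r)) with hμ₁
  set μ₂ : ℕ → ℝ := lconv B (r + k) β (gate δ[r + k] (m / ((r : ℝ) + k))) with hμ₂
  have hmix : ∀ h, lconv B (r + k) β (gate (TPL[r, k, g]) q) h = w * μ₁ h + (1 - w) * μ₂ h := by
    intro h
    have e : gate (TPL[r, k, g]) q = fun i => w * gate δ[r] (m / r) i + (1 - w) * gate δ[r + k] (m / ((r : ℝ) + k)) i :=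
      funext hsplit
    rw [e, lconv_lin_right]
  -- component 1: the blob of size r (read on the top r + k)
  have h₁ : SDEC x (B + (r + k)) μ₁ := by
    have e1 : μ₁ = lconv B r β (gate δ[r] (m / r)) := by
      funext h
      rw [hμ₁]
      refine lconv_top_right_of_le B r (r + k) β _ (by omega) (fun i hi => ?_) h
      rw [gate_apply, if_neg (by omega : i ≠ r), if_neg (by omega : i ≠ 0)]; ring
    have s1 : SDEC x (B + r) (lconv B r β (gate δ[r] (m / r))) := by
      rw [lconv_gate_point_eq_slice B r β (m / r) βM]
      exact sdec_slice' x (m / r) B r β hx0 hx1 hu hu1 β0 βM β1 hta hS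
    obtain ⟨g0', gM', g1'⟩ := gate_laws r δ[r] (m / r) (le_trans hx0.le hu) hu1 (fun h => by positivity)
      (fun h hh => if_neg (by omega)) (by simp)
    have gmn' : ∑ h ∈ Finset.range (r + 1), (h : ℝ) * gate δ[r] (m / r) h = m := by
      rw [sum_mul_gate]; simp; field_simp
    rw [e1]
    refine sdec_mono_top hx0 hx1 (lconv_nonneg B r β _ β0 g0') (fun h hh => lconv_eq_zero B r β _ h hh)
      (sum_lconv B r β _ β1 g1') (by omega) ?_ s1
    rw [sum_mul_lconv B r β _ β1 g1', gmn']; push_cast; nlinarith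
  -- component 2: the blob of size r + k
  have h₂ : SDEC x (B + (r + k)) μ₂ := by
    rw [hμ₂, lconv_gate_point_eq_slice B (r + k) β _ βM]
    exact sdec_slice' x _ B (r + k) β hx0 hx1 hv hv1 β0 βM β1 hta hS
  -- means
  obtain ⟨t0, tM, t1, tmn⟩ := glued_laws q g r k hq0.le hq1.le hg0 hg1
  obtain ⟨a0, aM, a1⟩ := gate_laws r δ[r] (m / r) (le_trans hx0.le hu) hu1 (fun h => by positivity) (fun h hh => if_neg (by omega)) (by simp)
  obtain ⟨b0, bM, b1⟩ := gate_laws (r + k) δ[r + k] (m / ((r : ℝ) + k)) (le_trans hx0.le hv) hv1 (fun h => by positivity)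
    (fun h hh => if_neg (by omega)) (by simp)
  have a1' : ∑ h ∈ Finset.range (r + k + 1), gate δ[r] (m / r) h = 1 := by
    rw [← Finset.sum_range_add_sum_Ico _ (by omega : r + 1 ≤ r + k + 1), a1]
    rw [Finset.sum_eq_zero (fun i hi => ?_), add_zero]
    rw [Finset.mem_Ico] at hi
    exact aM i (by omega)
  have amn' : ∑ h ∈ Finset.range (r + k + 1), (h : ℝ) * gate δ[r] (m / r) h = m := by
    rw [sum_mul_gate, sum_nat_mul_delta (r + k) r (by omega)]
    field_simp
  have bmn : ∑ h ∈ Finset.range (r + k + 1), (h : ℝ) * gate δ[r + k] (m / ((r : ℝ) + k)) h = m := by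
    rw [sum_mul_gate, sum_nat_mul_delta (r + k) (r + k) le_rfl]
    push_cast
    field_simp
  have hmμ : ∑ h ∈ Finset.range (B + (r + k) + 1), (h : ℝ) * lconv B (r + k) β (gate (TPL[r, k, g]) q) h = S + m := by
    rw [sum_mul_lconv _ _ _ _ β1 t1, tmn]
  have hm₁ : ∑ h ∈ Finset.range (B + (r + k) + 1), (h : ℝ) * μ₁ h = S + m := by rw [hμ₁, sum_mul_lconv _ _ _ _ β1 a1', amn']
  have hm₂ : ∑ h ∈ Finset.range (B + (r + k) + 1), (h : ℝ) * μ₂ h = S + m := by rw [hμ₂, sum_mul_lconv _ _ _ _ β1 b1, bmn]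
  exact sdec_of_mixture x (B + (r + k)) _ μ₁ μ₂ w hw0 hw1 hmix (by rw [hm₁, hmμ]) (by rw [hm₂, hmμ]) h₁ h₂

/-- **THE GLUED-PIECE SLICE FOR A LIGHT PIECE** (`r ≤ m = q(r+kg) ≤ 2r`): in `gluedPiece_split` the piece `{r, r+k; θ₃}` is LIGHT (`kθ₃ = m − r ≤ r`)
and affordable, so COMP-SLICE (`sdec_lightPiece`, arm-1 g57) replaces the margin; the blob part is `sdec_slice'`. [this work] -/
theorem sdec_gluedPiece_of_light {x : ℝ} (hx0 : 0 < x) (hx1 : x < 1) {B : ℕ} {β : ℕ → ℝ} (β0 : ∀ h, 0 ≤ β h)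
    (βM : ∀ h, B < h → β h = 0) (β1 : ∑ h ∈ Finset.range (B + 1), β h = 1)
    (hta : x * (B : ℝ) ≤ ∑ h ∈ Finset.range (B + 1), (h : ℝ) * β h) (hS : SDEC x B β)
    (q g : ℝ) (r k : ℕ) (hq0 : 0 < q) (hq1 : q < 1) (hg0 : 0 ≤ g) (hg1 : g ≤ 1) (hr : 1 ≤ r) (hk : 1 ≤ k)
    (haff : x * ((r : ℝ) + k) ≤ q * ((r : ℝ) + k * g)) (hmr : (r : ℝ) ≤ q * ((r : ℝ) + k * g))
    (hm2r : q * ((r : ℝ) + k * g) ≤ 2 * (r : ℝ)) :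
    SDEC x (B + (r + k)) (lconv B (r + k) β (gate (TPL[r, k, g]) q)) := by
  obtain ⟨hD, hw1, hw3, hsum, hθ3_0, hθ3_1, hθ1_0, hθ1_1, hsplit⟩ := gluedPiece_split q g r k hq0 hq1 hg1 hr hk hmr
  set m : ℝ := q * ((r : ℝ) + k * g) with hm
  set D : ℝ := (r : ℝ) + k - m with hDdef
  set w₁ : ℝ := (1 - q) * ((r : ℝ) + k) / D with hw₁
  set w₃ : ℝ := q * k * (1 - g) / D with hw₃
  set θ₁ : ℝ := m / ((r : ℝ) + k) with hθ₁
  set θ₃ : ℝ := (m - r) / k with hθ₃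
  set S : ℝ := ∑ h ∈ Finset.range (B + 1), (h : ℝ) * β h with hSdef
  have hk1 : (1 : ℝ) ≤ k := by exact_mod_cast hk
  have hr1 : (1 : ℝ) ≤ r := by exact_mod_cast hr
  have hk0 : (0 : ℝ) < k := by linarith
  have hrk0 : (0 : ℝ) < (r : ℝ) + k := by linarith
  have hxθ1 : x ≤ θ₁ := by rw [hθ₁]; exact (le_div_iff₀ hrk0).2 haff
  set μ₁ : ℕ → ℝ := lconv B (r + k) β (gate δ[r + k] θ₁) with hμ₁
  set μ₃ : ℕ → ℝ := lconv B (r + k) β (TPL[r, k, θ₃]) with hμ₃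
  have hw13 : 1 - w₁ = w₃ := by linarith
  have hmix : ∀ h, lconv B (r + k) β (gate (TPL[r, k, g]) q) h = w₁ * μ₁ h + (1 - w₁) * μ₃ h := by
    intro h
    have e : gate (TPL[r, k, g]) q = fun i => w₁ * gate δ[r + k] θ₁ i + w₃ * (TPL[r, k, θ₃]) i := funext hsplit
    rw [hw13, e, lconv_lin_right, hμ₁, hμ₃]
  have h₁ : SDEC x (B + (r + k)) μ₁ := by
    rw [hμ₁, lconv_gate_point_eq_slice B (r + k) β θ₁ βM]
    exact sdec_slice' x θ₁ B (r + k) β hx0 hx1 hxθ1 hθ1_1 β0 βM β1 hta hS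
  -- component 3: the LIGHT piece {r, r+k; θ₃}, by COMP-SLICE
  have h₃ : SDEC x (B + (r + k)) μ₃ := by
    have hlight : (k : ℝ) * θ₃ ≤ r := by
      rw [hθ₃, mul_div_cancel₀ _ hk0.ne']; linarith
    have haff3 : x * ((r : ℝ) + k) ≤ r + k * θ₃ := by
      rw [hθ₃, mul_div_cancel₀ _ hk0.ne']; linarith
    have key := sdec_lightPiece hx0 hx1 β0 βM β1 hta hS r k θ₃ hθ3_0 hθ3_1 hlight haff3
    rw [lconv_comm] at key
    have e : r + k + B = B + (r + k) := by omega
    rw [e] at key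
    exact key
  obtain ⟨p0, pM, p1, pmn, _⟩ := hs_facts r k θ₃ hθ3_0 hθ3_1
  obtain ⟨g0', gM', g1'⟩ := gate_laws (r + k) δ[r + k] θ₁ hθ1_0 hθ1_1 (fun h => by positivity) (fun h hh => if_neg (by omega)) (by simp)
  have gmn' : ∑ h ∈ Finset.range (r + k + 1), (h : ℝ) * gate δ[r + k] θ₁ h = m := by
    rw [sum_mul_gate, sum_nat_mul_delta (r + k) (r + k) le_rfl, hθ₁]
    push_cast
    field_simp
  obtain ⟨t0, tM, t1, tmn⟩ := glued_laws q g r k hq0.le hq1.le hg0 hg1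
  have hmμ : ∑ h ∈ Finset.range (B + (r + k) + 1), (h : ℝ) * lconv B (r + k) β (gate (TPL[r, k, g]) q) h = S + m := by
    rw [sum_mul_lconv _ _ _ _ β1 t1, tmn]
  have hm₁ : ∑ h ∈ Finset.range (B + (r + k) + 1), (h : ℝ) * μ₁ h = S + m := by
    rw [hμ₁, sum_mul_lconv _ _ _ _ β1 g1', gmn']
  have hm₃ : ∑ h ∈ Finset.range (B + (r + k) + 1), (h : ℝ) * μ₃ h = S + m := by
    rw [hμ₃, sum_mul_lconv _ _ _ _ β1 p1, pmn, hθ₃, mul_div_cancel₀ _ hk0.ne']; ring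
  have hw1' : w₁ ≤ 1 := by linarith
  exact sdec_of_mixture x (B + (r + k)) _ μ₁ μ₃ w₁ hw1 hw1' hmix (by rw [hm₁, hmμ]) (by rw [hm₃, hmμ]) h₁ h₃

/-- **THE GLUED-PIECE SLICE REDUCES TO ITS BAND.**  Given the band statement `hBand` (`β` SDEC + affordable at `x`, `0 < q < 1`, `0 ≤ g ≤ 1`,
`r, k ≥ 1`, `x ≤ qg`, `2r < q(r+kg)`, `q(r+kg) − r < kx` ⟹ `SDEC x (B+(r+k)) (β ∗ t)`), the glued-piece slice holds for EVERY affordable on-floor piece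
— exactly the hypothesis `hGPS` of arm-1 g57's `sdec_cons_of_okPieces`.  Dispatch on `m = q(r+kg)`: `m ≤ r` (`sdec_gluedPiece_of_low`), `r ≤ m ≤ 2r`
(`sdec_gluedPiece_of_light`), `kx ≤ m − r` (`sdec_gluedPiece_of_margin`), else the band. [this work] -/
theorem gluedPieceSlice_of_band {x : ℝ} (hx0 : 0 < x) (hx1 : x < 1)
    (hBand : ∀ (B' : ℕ) (β' : ℕ → ℝ) (r k : ℕ) (q g : ℝ), (∀ h, 0 ≤ β' h) → (∀ h, B' < h → β' h = 0) →
      ∑ h ∈ Finset.range (B' + 1), β' h = 1 → x * (B' : ℝ) ≤ ∑ h ∈ Finset.range (B' + 1), (h : ℝ) * β' h → SDEC x B' β' →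
      0 < q → q < 1 → 0 ≤ g → g ≤ 1 → 1 ≤ r → 1 ≤ k → x ≤ q * g → 2 * (r : ℝ) < q * ((r : ℝ) + k * g) →
      q * ((r : ℝ) + k * g) - r < (k : ℝ) * x →
      SDEC x (B' + (r + k)) (lconv B' (r + k) β' (gate (TPL[r, k, g]) q))) :
    ∀ (B' : ℕ) (β' : ℕ → ℝ) (r k : ℕ) (q g : ℝ), (∀ h, 0 ≤ β' h) → (∀ h, B' < h → β' h = 0) →
      ∑ h ∈ Finset.range (B' + 1), β' h = 1 → x * (B' : ℝ) ≤ ∑ h ∈ Finset.range (B' + 1), (h : ℝ) * β' h → SDEC x B' β' →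
      0 < q → q < 1 → 0 ≤ g → g ≤ 1 → 1 ≤ r → 1 ≤ k → x ≤ q * g → x * ((r : ℝ) + k) ≤ q * ((r : ℝ) + k * g) →
      SDEC x (B' + (r + k)) (lconv B' (r + k) β' (gate (TPL[r, k, g]) q)) := by
  intro B β r k q g β0 βM β1 hta hS hq0 hq1 hg0 hg1 hr hk hxqg haff
  by_cases hmr : q * ((r : ℝ) + k * g) ≤ r
  · exact sdec_gluedPiece_of_low hx0 hx1 β0 βM β1 hta hS q g r k hq0 hq1 hg0 hg1 hr hk haff hmr
  by_cases hm2r : q * ((r : ℝ) + k * g) ≤ 2 * (r : ℝ)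
  · exact sdec_gluedPiece_of_light hx0 hx1 β0 βM β1 hta hS q g r k hq0 hq1 hg0 hg1 hr hk haff (not_le.1 hmr).le hm2r
  by_cases hmargin : x ≤ (q * ((r : ℝ) + k * g) - r) / k
  · exact sdec_gluedPiece_of_margin hx0 hx1 β0 βM β1 hta hS q g r k hq0 hq1 hg0 hg1 hr hk haff (not_le.1 hmr).le hmargin
  · have hk1 : (1 : ℝ) ≤ k := by exact_mod_cast hk
    have hk0 : (0 : ℝ) < k := by linarith
    have hband2 : q * ((r : ℝ) + k * g) - r < (k : ℝ) * x := by
      have := not_le.1 hmargin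
      rw [div_lt_iff₀ hk0] at this
      linarith
    exact hBand B β r k q g β0 βM β1 hta hS hq0 hq1 hg0 hg1 hr hk hxqg (not_le.1 hm2r) hband2

/-- **THE NODE'S PIECEWISE CRITERION GIVEN THE BAND** (arm-1 g57's `sdec_cons_of_okPieces` with `hGPS` replaced by the band statement `hBand`): a law-OK
affordable sibling whose sub-forest law is a finite same-mean mixture of pieces each light / blob / floored / on-floor glued can be adjoined to ANY SDEC
forest of law-OK affordable siblings. [this work] -/
theorem sdec_cons_of_okPieces_of_band {x : ℝ} (hx0 : 0 < x) (hx1 : x < 1)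
    (hBand : ∀ (B' : ℕ) (β' : ℕ → ℝ) (r k : ℕ) (q g : ℝ), (∀ h, 0 ≤ β' h) → (∀ h, B' < h → β' h = 0) →
      ∑ h ∈ Finset.range (B' + 1), β' h = 1 → x * (B' : ℝ) ≤ ∑ h ∈ Finset.range (B' + 1), (h : ℝ) * β' h → SDEC x B' β' →
      0 < q → q < 1 → 0 ≤ g → g ≤ 1 → 1 ≤ r → 1 ≤ k → x ≤ q * g → 2 * (r : ℝ) < q * ((r : ℝ) + k * g) →
      q * ((r : ℝ) + k * g) - r < (k : ℝ) * x →
      SDEC x (B' + (r + k)) (lconv B' (r + k) β' (gate (TPL[r, k, g]) q)))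
    (L : List Sib) (s : Sib) (hL : ∀ t ∈ L, t.LawOK) (hxL : ∀ t ∈ L, x * (t.M : ℝ) ≤ t.q * t.mean) (hS : SDEC x (ftop L) (flaw L))
    (hs : s.LawOK) (hxs : x * (s.M : ℝ) ≤ s.q * s.mean)
    {ι : Type} [Fintype ι] (w : ι → ℝ) (lo K : ι → ℕ) (γ : ι → ℝ)
    (hw0 : ∀ i, 0 ≤ w i) (hw1 : ∑ i, w i = 1) (hγ : ∀ i, 0 ≤ γ i ∧ γ i ≤ 1) (htop : ∀ i, lo i + K i ≤ s.M)
    (hmean : ∀ i, (lo i : ℝ) + K i * γ i = s.mean) (hmix : ∀ h, s.ρ h = ∑ i, w i * (TPL[lo i, K i, γ i]) h)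
    (hOK : ∀ i, (K i : ℝ) * γ i ≤ lo i ∨ lo i = 0 ∨ x * (K i : ℝ) ≤ s.q * ((lo i : ℝ) + K i * γ i) - lo i ∨
      (1 ≤ lo i ∧ 1 ≤ K i ∧ x ≤ s.q * γ i)) :
    SDEC x (ftop (s :: L)) (flaw (s :: L)) :=
  sdec_cons_of_okPieces hx0 hx1 (gluedPieceSlice_of_band hx0 hx1 hBand) L s hL hxL hS hs hxs w lo K γ hw0 hw1 hγ htop hmean hmix hOK

/-- **`GluedDominated` ⟹ THE GLUED-PIECE SLICE, ALL REGIMES** — exactly the hypothesis `hGPS` of arm-1 g57's `sdec_cons_of_okPieces`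
(`…QuantPiecewiseSibling`): the band from `sdec_gluedPiece_band_of_dominated`, the rest from `gluedPieceSlice_of_band`. [this work] -/
theorem gluedPieceSlice_of_dominated (hD : GluedDominated) {x : ℝ} (hx0 : 0 < x) (hx1 : x < 1) :
    ∀ (B' : ℕ) (β' : ℕ → ℝ) (r k : ℕ) (q g : ℝ), (∀ h, 0 ≤ β' h) → (∀ h, B' < h → β' h = 0) →
      ∑ h ∈ Finset.range (B' + 1), β' h = 1 → x * (B' : ℝ) ≤ ∑ h ∈ Finset.range (B' + 1), (h : ℝ) * β' h → SDEC x B' β' →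
      0 < q → q < 1 → 0 ≤ g → g ≤ 1 → 1 ≤ r → 1 ≤ k → x ≤ q * g → x * ((r : ℝ) + k) ≤ q * ((r : ℝ) + k * g) →
      SDEC x (B' + (r + k)) (lconv B' (r + k) β' (gate (TPL[r, k, g]) q)) :=
  gluedPieceSlice_of_band hx0 hx1 fun _ _ r k q g β0 βM β1 hta hS hq0 hq1 hg0 hg1 hr hk hxqg hb1 hb2 =>
    sdec_gluedPiece_band_of_dominated hD hx0 hx1 β0 βM β1 hta hS q g r k hq0 hq1 hg0 hg1 hr hk hxqg hb1 hb2

/-- **`GluedDominated` ⟹ EVERY SIBLING WITH OK PIECES IS ADJOINABLE** (arm-1 g57's `sdec_cons_of_okPieces` with its hypothesis `hGPS` discharged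
from the conjecture): a law-OK affordable sibling whose sub-forest law is a finite same-mean mixture of pieces each light / blob / floored / on-floor
glued can be adjoined to ANY SDEC forest of law-OK affordable siblings.  By arm-1 g57's census (ARCH-G57 §7) every sampled tree-OK sibling has such
pieces. [this work] -/
theorem sdec_cons_of_okPieces_of_dominated (hD : GluedDominated) {x : ℝ} (hx0 : 0 < x) (hx1 : x < 1)
    (L : List Sib) (s : Sib) (hL : ∀ t ∈ L, t.LawOK) (hxL : ∀ t ∈ L, x * (t.M : ℝ) ≤ t.q * t.mean) (hS : SDEC x (ftop L) (flaw L))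
    (hs : s.LawOK) (hxs : x * (s.M : ℝ) ≤ s.q * s.mean)
    {ι : Type} [Fintype ι] (w : ι → ℝ) (lo K : ι → ℕ) (γ : ι → ℝ)
    (hw0 : ∀ i, 0 ≤ w i) (hw1 : ∑ i, w i = 1) (hγ : ∀ i, 0 ≤ γ i ∧ γ i ≤ 1) (htop : ∀ i, lo i + K i ≤ s.M)
    (hmean : ∀ i, (lo i : ℝ) + K i * γ i = s.mean) (hmix : ∀ h, s.ρ h = ∑ i, w i * (TPL[lo i, K i, γ i]) h)
    (hOK : ∀ i, (K i : ℝ) * γ i ≤ lo i ∨ lo i = 0 ∨ x * (K i : ℝ) ≤ s.q * ((lo i : ℝ) + K i * γ i) - lo i ∨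
      (1 ≤ lo i ∧ 1 ≤ K i ∧ x ≤ s.q * γ i)) :
    SDEC x (ftop (s :: L)) (flaw (s :: L)) :=
  sdec_cons_of_okPieces hx0 hx1 (gluedPieceSlice_of_dominated hD hx0 hx1) L s hL hxL hS hs hxs w lo K γ hw0 hw1 hγ htop hmean hmix hOK

end LawDec
end Quant
end Summit.CriticalPhenomena.PercolationContinuityZ3.Theorems
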